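import Summits.QuantumFields.BalabanUV.T4Continuum.Support.NE3SupControl
import Summits.QuantumFields.BalabanUV.T4Continuum.Support.AveragingDeficitPlaqDeriv
import Literature.MathematicalPhysics.QuantumFieldTheory.Balaban1983to89.BlockAveragingFederbush
import HarnessLib

/-!
# T⁴ programme, node NE3 — leaf E-SUP, file 2∕2: THE NORM MODULUS OF THE T-E_w DIRECTION FROM THE SMOOTHNESS OF THE PAIR

NE3 (node U1b) formalisation swarm `b2b-balaban-t4-ne3-formalise-*`, leaf seat `b2b-balaban-t4-ne3-formalise-leaf-01`
(gen 4), row **E-SUP** of `HOME/t4/formal/NE3/LEAVES.md` (supplier of record, owner RULING journal l.13447; INTENT file 2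
l.13752), companion of `Support/NE3SupControl` (p219137).

WHY.  T-E_w♯ (the owner's `NE3EnergyRateWSup`, D-CRUDE-w) carries the decaying sup `‖Z x κ‖ ≤ s·(L⁻¹)^k` as a conjunct
INSIDE the `∃ (u, Z)`; `NE3SupControl.norm_le_supConst_mul_inv_pow_four` discharges it from T-E_w's energy conjunct plus a
NORM MODULUS `(NM_λ) |‖Z(x+e_ν,κ)‖ − ‖Z(x,κ)‖| ≤ λ`, `λ = Λ∕(L^k)²` — a hypothesis on the PAIR, unprinted as such.  THIS
FILE (0 `def`, 0 `sorry`) reduces that pair hypothesis, by pure algebra at one pair, to TWO SINGLE-FIELD step-Lipschitz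
moduli — of `U := U_A^u = W·e^Z` (`vary W Z 1`) and of `W` itself, in the common gauge the chart fixes (the (9)-TYPE
objects) — plus the UNIFORM smallness `‖Z‖_∞ ≤ σ ≤ ½` that `NE3SupControl` §1 (s-a) already extracts from T-E_w's energy
conjunct under the datum smallness:
§1 `exp_dir_eq_star_mul_vary` (`e^{Z(b)} = W(b)⋆·U(b)`), `norm_exp_dir_sub_le` (`‖e^{Z(b′)} − e^{Z(b)}‖ ≤ ‖U(b′) − U(b)‖ +
   ‖W(b′) − W(b)‖`, unitary isometries), **`norm_dir_sub_le_of_pair_lipschitz`**: for `‖Z(b)‖ ≤ σ < ln 2`,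
   `‖Z(b′) − Z(b)‖ ≤ (1 + ρ∕(1−ρ))·(λ_U + λ_W)`, `ρ = e^σ − 1` (`B7BlockAvgLog.mlog_exp` + the mean-value bound
   `FederbushMean.norm_mlog_sub_mlog_le` BY NAME); `_half`: `σ ≤ ½ ⇒ ≤ 3·(λ_U + λ_W)` (`e^{1∕2} < 1.65`);
§2 **`norm_le_of_pair_lipschitz_four`** — E-SUP's END in the consumer display with the pair hypothesis REPLACED: at `d = 4`,
   `1 ≤ L, N, k`, T-E_w's energy conjunct `energyNormW … ≤ C·residualScale 4 L N b g k` (`C ≥ 0`), the two moduli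
   `λ_U + λ_W ≤ Λ₀∕(L^k)²` (`Λ₀ ≥ 0`), and the datum smallness `C·S₀ ≤ ½`, `S₀ = wallConst 4 L·N²·(√g·dualC2 4 L∕L + 2b²·dualC1 4 L∕L⁵)`:
   `‖Z x κ‖ ≤ (12Λ₀ + C·S₀)·(L⁻¹)^k` at every site.

HONEST FRAMING.  Matrix algebra at ONE pair (our frame, [folklore]); the two single-field moduli are HYPOTHESIS SHAPES
(printed context: [Balaban1985Variational] Thm 1 (9) p. 279 — regularity of the minimiser in its gauge; for `W = cavg L U_B` in
the SAME frame nothing is printed); nothing about minimisers is proved; T-E_w♯ ∕ (ML_w) ∕ (RES♯) NOT proved; **NE3 is NOT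
proved**; spine PROVED 0∕9; finite T⁴ rung (B)+1 — NOT infinite volume, NOT mass gap, NOT `BetaPertH`, NOT Clay.  PLACEMENT:
`Summits/QuantumFields/BalabanUV/`.  HONEST DEPENDENCY (cell page 1): continuum YM on T⁴ ⇐ BetaPertH ∧ nine spine estimates
(0/9 proved); BetaPertH ⇐ (D1) ∧ (D4) ∧ CAP+tail; G-an2-4 gates asym, D1 and NE2/3/4.
-/

set_option autoImplicit false

open scoped BigOperators Matrix Matrix.Norms.L2Operator
open NormedSpace Finset

namespace Summit.QuantumFields.BalabanUV.T4Continuum.NE3SupModulus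

open Literature.MathematicalPhysics.QuantumFieldTheory.Balaban1983to89
open B7Prop1Explicit B7Prop2Explicit MatrixLog
open T4AveragingDeficitWall hiding Site Plane Plaq Bond
open T4AveragingDeficitWallBoundary (periodBox)
open AveragingDeficitPeriodicCounting (IsPeriodicDir)
open AveragingDeficitDerivWallProof (wallConst)
open AveragingDeficitDualResidual (dualC1 dualC2)
open AveragingDeficitPlaqDeriv (vary_isUnitaryCfg)
open NE3EnergyShapes (residualScale)
open NE3EnergyWeightedShapes (energyNormW)
open NE3SupControl (norm_le_uniform_four norm_le_supConst_mul_inv_pow_four normModulus_of_lipschitz)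

noncomputable section

variable {d : ℕ} {n : Type*} [Fintype n] [DecidableEq n]

/-! ## §1 The chart `Z(b) = log (W(b)⋆ U(b))` is Lipschitz in the pair -/

/-- `e^{Z(b)} = W(b)⋆ · U(b)` for `U = vary W Z 1` and unitary `W`. [folklore] -/
theorem exp_dir_eq_star_mul_vary {W : Site d → Fin d → (Matrix n n ℂ)ˣ} (hW : IsUnitaryCfg W)
    (Z : Site d → Fin d → Matrix n n ℂ) (x : Site d) (κ : Fin d) :
    exp (Z x κ) = star ((W x κ : (Matrix n n ℂ)ˣ) : Matrix n n ℂ) * ((vary W Z 1 x κ : (Matrix n n ℂ)ˣ) : Matrix n n ℂ) := by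
  have hu : ((W x κ : (Matrix n n ℂ)ˣ) : Matrix n n ℂ) ∈ unitary (Matrix n n ℂ) := (mem_unitaryUnits).mp (hW x κ)
  simp only [vary, Units.val_mul, val_expUnit, one_smul, Complex.ofReal_one]
  rw [← mul_assoc, Unitary.star_mul_self_of_mem hu, one_mul]

/-- **THE EXPONENTIALS OF THE DIRECTION ARE LIPSCHITZ IN THE PAIR**: for unitary `W`, skew `Z`, `U = vary W Z 1`, and two bonds
`b = (x,κ)`, `b′ = (x′,κ′)`: `‖e^{Z(b′)} − e^{Z(b)}‖ ≤ ‖U(b′) − U(b)‖ + ‖W(b′) − W(b)‖` (unitary isometries of `M_N(ℂ)`; the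
units-ratio dress of the same inequality is `UnitaryGeodesic.norm_ratio_sub_ratio_le`, stated here in the `W⋆·U` dress without
the `Nontrivial` instance). [folklore] -/
theorem norm_exp_dir_sub_le {W : Site d → Fin d → (Matrix n n ℂ)ˣ} (hW : IsUnitaryCfg W) {Z : Site d → Fin d → Matrix n n ℂ}
    (hZ : IsSkewDir Z) (x x' : Site d) (κ κ' : Fin d) :
    ‖exp (Z x' κ') - exp (Z x κ)‖
      ≤ ‖((vary W Z 1 x' κ' : (Matrix n n ℂ)ˣ) : Matrix n n ℂ) - (vary W Z 1 x κ : (Matrix n n ℂ)ˣ)‖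
        + ‖((W x' κ' : (Matrix n n ℂ)ˣ) : Matrix n n ℂ) - (W x κ : (Matrix n n ℂ)ˣ)‖ := by
  set U := vary W Z 1 with hUdef
  have hUu : IsUnitaryCfg U := vary_isUnitaryCfg hW hZ 1
  have hW' : ((W x' κ' : (Matrix n n ℂ)ˣ) : Matrix n n ℂ) ∈ unitary (Matrix n n ℂ) := (mem_unitaryUnits).mp (hW x' κ')
  have hWx : ((W x κ : (Matrix n n ℂ)ˣ) : Matrix n n ℂ) ∈ unitary (Matrix n n ℂ) := (mem_unitaryUnits).mp (hW x κ)
  have hUx : ((U x κ : (Matrix n n ℂ)ˣ) : Matrix n n ℂ) ∈ unitary (Matrix n n ℂ) := (mem_unitaryUnits).mp (hUu x κ)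
  rw [exp_dir_eq_star_mul_vary hW Z x' κ', exp_dir_eq_star_mul_vary hW Z x κ]
  set w' := ((W x' κ' : (Matrix n n ℂ)ˣ) : Matrix n n ℂ)
  set w := ((W x κ : (Matrix n n ℂ)ˣ) : Matrix n n ℂ)
  set u' := ((U x' κ' : (Matrix n n ℂ)ˣ) : Matrix n n ℂ)
  set u := ((U x κ : (Matrix n n ℂ)ˣ) : Matrix n n ℂ)
  have hsplit : star w' * u' - star w * u = star w' * (u' - u) + star (w' - w) * u := by
    rw [star_sub]; noncomm_ring
  rw [hsplit]
  calc ‖star w' * (u' - u) + star (w' - w) * u‖ ≤ ‖star w' * (u' - u)‖ + ‖star (w' - w) * u‖ := norm_add_le _ _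
    _ = ‖u' - u‖ + ‖w' - w‖ := by
        rw [CStarRing.norm_mem_unitary_mul _ (Unitary.star_mem hW'), CStarRing.norm_mul_mem_unitary _ hUx, norm_star]

/-- **THE DIRECTION IS LIPSCHITZ IN THE PAIR** (general smallness): for unitary `W`, skew `Z` with `‖Z(b)‖ ≤ σ < ln 2` everywhere,
`U = vary W Z 1`, and step-Lipschitz moduli `λ_U` of `U` and `λ_W` of `W`:
`‖Z(x+e_ν,κ) − Z(x,κ)‖ ≤ (1 + ρ∕(1−ρ))·(λ_U + λ_W)`, `ρ = e^σ − 1 < 1` (`Z(b) = log e^{Z(b)}` on `‖·‖ < ln 2`,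
`B7BlockAvgLog.mlog_exp`; mean-value bound `FederbushMean.norm_mlog_sub_mlog_le`). [folklore] -/
theorem norm_dir_sub_le_of_pair_lipschitz {W : Site d → Fin d → (Matrix n n ℂ)ˣ} (hW : IsUnitaryCfg W)
    {Z : Site d → Fin d → Matrix n n ℂ} (hZ : IsSkewDir Z) {σ : ℝ} (hZσ : ∀ (x : Site d) (κ : Fin d), ‖Z x κ‖ ≤ σ)
    (hσ : σ < Real.log 2) {lamU lamW : ℝ}
    (hU : ∀ (x : Site d) (ν κ : Fin d),
      ‖((vary W Z 1 (x + e ν) κ : (Matrix n n ℂ)ˣ) : Matrix n n ℂ) - (vary W Z 1 x κ : (Matrix n n ℂ)ˣ)‖ ≤ lamU)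
    (hWl : ∀ (x : Site d) (ν κ : Fin d),
      ‖((W (x + e ν) κ : (Matrix n n ℂ)ˣ) : Matrix n n ℂ) - (W x κ : (Matrix n n ℂ)ˣ)‖ ≤ lamW)
    (x : Site d) (ν κ : Fin d) :
    ‖Z (x + e ν) κ - Z x κ‖ ≤ (1 + (Real.exp σ - 1) / (1 - (Real.exp σ - 1))) * (lamU + lamW) := by
  -- the two exponentials are within ρ of 1
  have hρ : Real.exp σ - 1 < 1 := by
    have : Real.exp σ < 2 := by
      calc Real.exp σ < Real.exp (Real.log 2) := Real.exp_lt_exp.mpr hσ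
        _ = 2 := Real.exp_log (by norm_num)
    linarith
  have hA : ∀ (y : Site d) (μ : Fin d), ‖exp (Z y μ) - 1‖ ≤ Real.exp σ - 1 := fun y μ =>
    B7Transfer.norm_exp_sub_one_le_of_le (Z y μ) (hZσ y μ)
  have hlog : ∀ (y : Site d) (μ : Fin d), mlog (exp (Z y μ)) = Z y μ := fun y μ =>
    B7BlockAvgLog.mlog_exp ((hZσ y μ).trans_lt hσ)
  have h1 := FederbushMean.norm_mlog_sub_mlog_le hρ (hA (x + e ν) κ) (hA x κ)
  rw [hlog, hlog] at h1
  have h2 := norm_exp_dir_sub_le hW hZ x (x + e ν) κ κ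
  have hK : 0 ≤ 1 + (Real.exp σ - 1) / (1 - (Real.exp σ - 1)) := by
    have h0 : 0 ≤ Real.exp σ - 1 := by
      have := hA x κ
      exact (norm_nonneg _).trans this
    have : 0 ≤ (Real.exp σ - 1) / (1 - (Real.exp σ - 1)) := div_nonneg h0 (by linarith)
    linarith
  calc ‖Z (x + e ν) κ - Z x κ‖ ≤ (1 + (Real.exp σ - 1) / (1 - (Real.exp σ - 1))) * ‖exp (Z (x + e ν) κ) - exp (Z x κ)‖ := h1
    _ ≤ (1 + (Real.exp σ - 1) / (1 - (Real.exp σ - 1))) * (lamU + lamW) :=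
        mul_le_mul_of_nonneg_left (h2.trans (add_le_add (hU x ν κ) (hWl x ν κ))) hK

omit [Fintype n] [DecidableEq n] in
/-- `e^{1∕2} < 1.65` (from `e < 2.7182818286`). [folklore] -/
theorem exp_half_lt : Real.exp (1 / 2) < 1.65 := by
  have h1 := Real.exp_one_lt_d9
  have h2 : Real.exp (1 / 2) * Real.exp (1 / 2) = Real.exp 1 := by rw [← Real.exp_add]; norm_num
  nlinarith [Real.exp_pos (1 / 2 : ℝ)]

/-- **THE DIRECTION IS LIPSCHITZ IN THE PAIR, `σ ≤ ½`**: `‖Z(x+e_ν,κ) − Z(x,κ)‖ ≤ 3·(λ_U + λ_W)` (`ρ = e^σ − 1 ≤ 0.65`,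
`1 + ρ∕(1−ρ) ≤ 3`). [folklore] -/
theorem norm_dir_sub_le_of_pair_lipschitz_half {W : Site d → Fin d → (Matrix n n ℂ)ˣ} (hW : IsUnitaryCfg W)
    {Z : Site d → Fin d → Matrix n n ℂ} (hZ : IsSkewDir Z) {σ : ℝ} (hZσ : ∀ (x : Site d) (κ : Fin d), ‖Z x κ‖ ≤ σ)
    (hσ : σ ≤ 1 / 2) {lamU lamW : ℝ} (hlam : 0 ≤ lamU + lamW)
    (hU : ∀ (x : Site d) (ν κ : Fin d),
      ‖((vary W Z 1 (x + e ν) κ : (Matrix n n ℂ)ˣ) : Matrix n n ℂ) - (vary W Z 1 x κ : (Matrix n n ℂ)ˣ)‖ ≤ lamU)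
    (hWl : ∀ (x : Site d) (ν κ : Fin d),
      ‖((W (x + e ν) κ : (Matrix n n ℂ)ˣ) : Matrix n n ℂ) - (W x κ : (Matrix n n ℂ)ˣ)‖ ≤ lamW)
    (x : Site d) (ν κ : Fin d) : ‖Z (x + e ν) κ - Z x κ‖ ≤ 3 * (lamU + lamW) := by
  have hlog2 := Real.log_two_gt_d9
  have hσ' : σ < Real.log 2 := by linarith
  have h := norm_dir_sub_le_of_pair_lipschitz hW hZ hZσ hσ' hU hWl x ν κ
  have hρ : Real.exp σ - 1 ≤ 0.65 := by
    have := Real.exp_le_exp.mpr hσ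
    linarith [exp_half_lt]
  have hK : 1 + (Real.exp σ - 1) / (1 - (Real.exp σ - 1)) ≤ 3 := by
    have hpos : 0 < 1 - (Real.exp σ - 1) := by linarith
    have : (Real.exp σ - 1) / (1 - (Real.exp σ - 1)) ≤ 2 := by
      rw [div_le_iff₀ hpos]; linarith
    linarith
  exact h.trans (mul_le_mul_of_nonneg_right hK hlam)

/-! ## §2 E-SUP's END with the pair hypothesis replaced by the two single-field moduli -/

/-- **E-SUP FROM T-E_w's ENERGY CONJUNCT, THE TWO SINGLE-FIELD MODULI AND THE DATUM SMALLNESS** (consumer display of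
T-E_w♯'s conjunct, `d = 4`): for `1 ≤ L, N, k`, unitary `W`, skew `(N·L^k)`-periodic `Z`, `U = vary W Z 1`, step-Lipschitz
moduli with `λ_U + λ_W ≤ Λ₀∕(L^k)²` (`Λ₀ ≥ 0`), `energyNormW L k W Z (periodBox (N·L^k)) ≤ C·residualScale 4 L N b g k`
(`C ≥ 0`) and the datum smallness `C·S₀ ≤ ½`, `S₀ = wallConst 4 L·N²·(√g·dualC2 4 L∕L + 2b²·dualC1 4 L∕L⁵)`:
`‖Z x κ‖ ≤ (12Λ₀ + C·S₀)·(L⁻¹)^k` at every site. [folklore] -/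
theorem norm_le_of_pair_lipschitz_four {L N k : ℕ} (hL : 1 ≤ L) (hN : 1 ≤ N) (hk : 1 ≤ k)
    {W : Site 4 → Fin 4 → (Matrix n n ℂ)ˣ} (hW : IsUnitaryCfg W) {Z : Site 4 → Fin 4 → Matrix n n ℂ} (hZ : IsSkewDir Z)
    (hZP : IsPeriodicDir Z ((N * L ^ k : ℕ) : ℤ)) {lamU lamW Λ₀ : ℝ} (hΛ₀ : 0 ≤ Λ₀)
    (hU : ∀ (x : Site 4) (ν κ : Fin 4),
      ‖((vary W Z 1 (x + e ν) κ : (Matrix n n ℂ)ˣ) : Matrix n n ℂ) - (vary W Z 1 x κ : (Matrix n n ℂ)ˣ)‖ ≤ lamU)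
    (hWl : ∀ (x : Site 4) (ν κ : Fin 4),
      ‖((W (x + e ν) κ : (Matrix n n ℂ)ˣ) : Matrix n n ℂ) - (W x κ : (Matrix n n ℂ)ˣ)‖ ≤ lamW)
    (hlam : lamU + lamW ≤ Λ₀ / ((L : ℝ) ^ k) ^ 2) {b g C : ℝ} (hC : 0 ≤ C)
    (hE : energyNormW L k W Z (periodBox (N * L ^ k)) ≤ C * residualScale 4 L N b g k)
    (hsmall : C * (wallConst 4 L * (N : ℝ) ^ 2 * (Real.sqrt g * dualC2 4 L / L + 2 * b ^ 2 * dualC1 4 L / (L : ℝ) ^ 5))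
      ≤ 1 / 2) (x : Site 4) (κ : Fin 4) :
    ‖Z x κ‖ ≤ (12 * Λ₀ + C * (wallConst 4 L * (N : ℝ) ^ 2
        * (Real.sqrt g * dualC2 4 L / L + 2 * b ^ 2 * dualC1 4 L / (L : ℝ) ^ 5))) * ((L : ℝ)⁻¹) ^ k := by
  have hM : 1 ≤ N * L ^ k := Nat.le_mul_of_pos_right N (Nat.one_le_pow k L (by omega)) |>.trans' hN
  have hlam0 : 0 ≤ lamU + lamW :=
    add_nonneg ((norm_nonneg _).trans (hU x 0 κ)) ((norm_nonneg _).trans (hWl x 0 κ))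
  -- (U): the uniform bound from the energy conjunct gives the smallness of the chart
  have hσ : ∀ (y : Site 4) (μ : Fin 4), ‖Z y μ‖ ≤ C * (wallConst 4 L * (N : ℝ) ^ 2
      * (Real.sqrt g * dualC2 4 L / L + 2 * b ^ 2 * dualC1 4 L / (L : ℝ) ^ 5)) :=
    fun y μ => norm_le_uniform_four hL hk hM hZP hC hE y μ
  -- the pair moduli give a plain Lipschitz modulus `3(λ_U + λ_W) ≤ 3Λ₀/(L^k)²`, hence the norm modulus
  have hlip : ∀ (y : Site 4) (ν μ : Fin 4), ‖Z (y + e ν) μ - Z y μ‖ ≤ 3 * Λ₀ / ((L : ℝ) ^ k) ^ 2 := fun y ν μ =>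
    (norm_dir_sub_le_of_pair_lipschitz_half hW hZ hσ hsmall hlam0 hU hWl y ν μ).trans
      (by rw [mul_div_assoc]; exact mul_le_mul_of_nonneg_left hlam (by norm_num))
  have hmod := normModulus_of_lipschitz hlip
  have h := norm_le_supConst_mul_inv_pow_four hL hN hk hZP (by positivity : (0 : ℝ) ≤ 3 * Λ₀) hmod hC hE x κ
  calc ‖Z x κ‖ ≤ _ := h
    _ = _ := by ring

end

end Summit.QuantumFields.BalabanUV.T4Continuum.NE3SupModulus
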